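import Literature.Probability.LatticeModels.RectangleSideHarmonicMeasure
import Literature.Probability.LatticeModels.HalfPlanePoissonKernel
import Literature.Probability.LatticeModels.DirichletGreenFunction
import Literature.Probability.LatticeModels.LatticeHarnackOneScale
import Literature.Probability.LatticeModels.LatticeDirichletEnergy
import HarnessLib

/-!
# A priori bounds for the Dirichlet Green function of a planar lattice domain at a pole next to a
# flat boundary stretch

Topic `Literature/Probability/LatticeModels` (discrete potential theory on `ℤ²`, continuing
`RectangleSideHarmonicMeasure.lean`, `HalfPlanePoissonKernel.lean`, `DirichletGreenFunction.lean`).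
Second instalment of the inline proof programme for the tree fact
`ChelkakSmirnov2011_boundaryNormalisedPoissonKernelLimit` (`FlatBoundaryPoissonKernelLimit.lean`;
D. Chelkak, S. Smirnov, Adv. Math. 228 (2011), Thm. 3.13, bib key `ChelkakSmirnov2011`), whose
discrete Poisson kernel is `P^δ = G_V(·, b) · δ / G_V(a, b)` with `G_V = dirichletGreen V`
(`(4 - A)⁻¹`) and the pole `b` a lattice point adjacent to the killed row under a FLAT boundary
point. The printed proof of Thm. 3.13 ("Repeating the arguments given in the proof of Theorem 3.10,
one obtains that … the functions `P^δ` are uniformly bounded everywhere in `Ω^δ_r`") takes its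
a priori sup bound away from the pole from the crosscut argument of Thm. 3.10 (Lemma 3.11 on
extremal length and Thm. 3.8 on the convergence of discrete harmonic measures). For a pole at a
flat boundary point of `ℤ²` the tree has a shorter road, written out here: compare `G_V(b, ·)` with
the explicit Poisson kernel of the discrete half-plane (`hpPoisson`, Lawler–Limic 2010 §8.1) on a
window around the pole and close the estimates by the maximum principle.

* `hpK_le_inv` — the uniform bound `K_s(m) ≤ 1/(π c₀ s)` on the half-plane kernel
  (`ρ(θ) = e^{-μ(θ)} ≤ e^{-c₀ θ}`, `c₀ = modeRateConst` of `BoxDirichlet.lean`), complementing the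
  decay bound `K_s(m) ≤ 2s/(π m²)` of `HalfPlanePoissonKernel.lean`; `hpPoisson_le_inv`.
* `latticeLaplacian_dirichletGreen` (`Δ G_Λ(b,·) = -δ_b` on `Λ`), `isLatticeHarmonicOn_dirichletGreen`
  — the `dirichletGreen` of `DirichletGreenFunction.lean` fed to the `ℤ²` maximum principles through
  the (private) bridge between the two lattice Laplacians of the tree (cf.
  `latticeLaplacian_eq_latticeLaplacianZd`, `HarmonicFlatBoundaryRow.lean`).
* `polePoisson b = hpPoisson (· - b)` (pole data at `b - e₁`), its harmonicity on the rows `≥ b₁`,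
  boundary row, and the bounds `polePoisson_le_inv/_le_decay/_le_sphere/_le_far`;
  `latticeLaplacian_dirichletGreen_add_indicator`: lifting the pole to the boundary row,
  `Ĝ = G_Λ(b,·) + 1_{b - e₁}` is harmonic at `b` as well.
* `dirichletGreen_le_polePoisson_add` — **window comparison (upper)**: if `Λ` agrees with the upper
  half-plane in the window `|z₀ - b₀| ≤ W`, `|z₁ - b₁| ≤ W` and `G_Λ(b,·) ≤ M` on the far sides of
  the window rectangle, then `G_Λ(b,·) ≤ P_b + M (ω_U + ω_V)` on it (`le_sides_latticeHM`).
* `sides_latticeHM_le_half` — low in the middle of a `2W × W` rectangle (`|X| ≤ ρ`, `Y ≤ ρ`,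
  `W ≥ 8ρ`) the side harmonic measures satisfy `ω_U + ω_V ≤ 1/2` (barriers `h₂`, `h₃` of
  Chelkak–Smirnov's Lemma 3.12, `RectangleSideHarmonicMeasure.lean`); `latticeHM_top_add_sides_le_one`.
* `dirichletGreen_le_flatPoleConst_div` — **the a priori upper bound**: under the window hypothesis
  with `W ≥ 8ρ`, `ρ ≥ 2`, `G_Λ(b, z) ≤ flatPoleConst/ρ` for all `z ∈ Λ` at sup-distance `≥ ρ` from `b`
  (`flatPoleConst = 2(1/(π c₀) + 8/π)`): the maximum `F*` over those `z` sits, by the maximum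
  principle, next to the sup-sphere of radius `ρ - 1`, where the window comparison and the kernel
  bounds give `F* ≤ C₁/ρ + F*/2`. In the mesh-`δ` picture (`ρ ≍ d/δ`): `G_V(z, b) = O(δ/d)` off
  `B(y, d)`, uniformly in the domain.
* `windowFinset`; `polePoisson_sub_le_dirichletGreen_window` — **window comparison (lower)**: `G_R(b,·) ≥ P_b - M'`
  on the window domain `R` when `P_b ≤ M'` on its far sides; `dirichletGreen_axis_ge` — **lower bound
  on the axis above the pole**: `G_Λ(b, (b₀, b₁ + t - 1)) ≥ 1/(4t) - (1/(π c₀) + 2/π)/W` whenever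
  `Λ` contains the window (`dirichletGreen_mono` of `LatticeDirichletEnergy.lean`, `K_t(0) ≥ 1/(4t)`,
  `hpPoisson_axis_ge`). In the mesh-`δ` picture:
  `G_V(T_b, b) ≳ δ/t` at height `t` above the pole.

* `holeFree_sqBox`, `harnack_box`, `harnack_chain` — closed square boxes are hole-free, so the
  one-scale Harnack inequality of `LatticeHarnackOneScale.lean` applies on boxes and chains along a
  corridor of boxes (`h(c_J) ≥ (c_*/2)^J h(c₀)`); `mul_latticeHM_top_le`, `base_value_ge` — a
  nonnegative harmonic function on the `2S × T` rectangle which is `≥ m` on the top side is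
  `≥ m ω_U ≥ m (1/T - T/S²)` at the point next to the middle of the base (Lemma 3.12 again: the step
  "`δ ≍ P(o_int) ≥ const · P(T^δ) · ω(o_int; U; R)`" of the proof of Thm. 3.13).
* `dirichletGreen_pole_ge` — **the a priori lower bound** assembled on the lattice (both ends in
  "base below" position): window above the pole, a Harnack chain of boxes inside `Λ ∖ {b}` from the
  axis point `T_b` to the top side of the rectangle under `a`:
  `G_Λ(a, b) ≥ (1/T - T/S²) (c_*/2)^{J+1} / (8t)`. In the mesh-`δ` picture all of `W, t, k, S, T`
  scale like `1/δ` and `J` stays bounded, i.e. `G_V(a, b) ≳ δ²` — equivalently the uniform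
  boundedness of `P^δ` on compacts.

* `dirichletGreen_chain_ge`, `dirichletGreen_base_ge` — the two halves of the lower bound separately
  (into the bulk from the pole; into the normalisation point from the bulk), for use when the two
  boundary points have different orientations; `eq_dirichletGreen_of_latticeLaplacian`,
  `dirichletGreen_map_motion` — uniqueness characterisation of `G_Λ(x, ·)` and **invariance of the
  Green function under bijective lattice motions** (`G_{σΛ}(σx, σy) = G_Λ(x, y)`), with the vertical
  flip `flipV` and the transposition `transposeSite` as lattice motions, which reduce the other
  three orientations of a flat boundary stretch to "base below".

Everything is proved; no named fact. Not here: the existence of the corridor for the lattice approximations of a rectilinear domain, compactness and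
the identification of the limit — the remaining steps of Thm. 3.13.

## References

* D. Chelkak, S. Smirnov, *Discrete complex analysis on isoradial graphs*, Adv. Math. 228 (2011)
  1590–1630, §3.4–3.5 (proofs of Thms. 3.10, 3.13) — `ChelkakSmirnov2011`.
* G. F. Lawler, V. Limic, *Random Walk: A Modern Introduction* (2010), §8.1 — `LawlerLimic2010`.
* G. F. Lawler, *Intersections of Random Walks* (1991), §1.5 — `Lawler1991`.
* G. F. Lawler, O. Schramm, W. Werner, Ann. Probab. 32 (2004), Lemma 5.2 — `LawlerSchrammWerner2004`.
-/

noncomputable section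

namespace Literature.Probability.LatticeModels

open Set

section HalfPlaneKernelUniform

open Real MeasureTheory intervalIntegral

/-- `ρ(θ) = e^{-μ(θ)}`: the decaying mode of the discrete Laplace equation of
`HalfPlanePoissonKernel.lean` is the exponential of minus the mode rate `μ(θ) = arcosh(2 - cos θ)`
of `BoxDirichlet.lean`. [folklore] -/
theorem hpMode_eq_exp_neg_modeRate (θ : ℝ) : hpMode θ = Real.exp (-modeRate θ) := by
  rw [hpMode_eq_inv, Real.exp_neg, modeRate, Real.exp_arcosh (one_le_two_sub_cos θ)]
  rfl

/-- `ρ(θ) ≤ e^{-c₀ θ}` on `[0, π]`, `c₀ = modeRateConst`. [folklore] -/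
theorem hpMode_le_exp_neg {θ : ℝ} (hθ0 : 0 ≤ θ) (hθπ : θ ≤ π) :
    hpMode θ ≤ Real.exp (-(modeRateConst * θ)) := by
  rw [hpMode_eq_exp_neg_modeRate, Real.exp_le_exp, neg_le_neg_iff]
  have h := modeRateConst_mul_le (θ := θ) (by rw [abs_of_nonneg hθ0]; exact hθπ)
  rwa [abs_of_nonneg hθ0] at h

/-- **Uniform bound on the half-plane kernel**: `K_s(m) ≤ 1/(π c₀ s)` for `s ≥ 1` and every `m`
(`|cos| ≤ 1`, `ρ ≤ e^{-c₀θ}`, `∫₀^π e^{-c₀ s θ} dθ ≤ 1/(c₀ s)`). Together with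
`hpK_le_of_ne_zero` (`K_s(m) ≤ 2s/(π m²)`) this is the lattice form of
`(1/π) y/(x² + y²) ≤ min(1/(π y), y/(π x²))`. [folklore] -/
theorem hpK_le_inv {s : ℕ} (hs : 1 ≤ s) (m : ℤ) : hpK s m ≤ 1 / (π * modeRateConst * s) := by
  have hs0 : (0 : ℝ) < s := by exact_mod_cast hs
  have hc0 := modeRateConst_pos
  unfold hpK
  have hle : ∫ θ in (0 : ℝ)..π, Real.cos (m * θ) * hpMode θ ^ s ≤
      ∫ θ in (0 : ℝ)..π, Real.exp (-(modeRateConst * s) * θ) := by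
    refine intervalIntegral.integral_mono_on Real.pi_pos.le
      ((continuous_cos_mul_hpMode_pow s m).intervalIntegrable (μ := volume) _ _)
      ((Real.continuous_exp.comp (continuous_const.mul continuous_id)).intervalIntegrable
        (μ := volume) _ _) fun θ hθ => ?_
    have hρ0 : 0 ≤ hpMode θ := (hpMode_pos θ).le
    calc Real.cos (m * θ) * hpMode θ ^ s ≤ 1 * hpMode θ ^ s :=
          mul_le_mul_of_nonneg_right (Real.cos_le_one _) (pow_nonneg hρ0 s)
      _ ≤ Real.exp (-(modeRateConst * θ)) ^ s := by
          rw [one_mul]; exact pow_le_pow_left₀ hρ0 (hpMode_le_exp_neg hθ.1 hθ.2) s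
      _ = Real.exp (-(modeRateConst * s) * θ) := by
          rw [← Real.exp_nat_mul]; congr 1; ring
  have hcs : modeRateConst * s ≠ 0 := (mul_pos hc0 hs0).ne'
  rw [integral_exp_neg_mul hcs] at hle
  have hle' : (1 - Real.exp (-(modeRateConst * s) * π)) / (modeRateConst * s) ≤
      1 / (modeRateConst * s) :=
    div_le_div_of_nonneg_right (by linarith [Real.exp_pos (-(modeRateConst * s) * π)])
      (mul_pos hc0 hs0).le
  calc π⁻¹ * ∫ θ in (0 : ℝ)..π, Real.cos (m * θ) * hpMode θ ^ s
      ≤ π⁻¹ * (1 / (modeRateConst * s)) :=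
        mul_le_mul_of_nonneg_left (hle.trans hle') (inv_nonneg.2 Real.pi_pos.le)
    _ = 1 / (π * modeRateConst * s) := by
        field_simp

/-- `hpPoisson (m, y) ≤ 1/(π c₀ (y + 1))` for `y ≥ 0`. [folklore] -/
theorem hpPoisson_le_inv (v : Site 2) (h1 : 0 ≤ v 1) :
    hpPoisson v ≤ 1 / (π * modeRateConst * ((v 1 : ℝ) + 1)) := by
  rw [hpPoisson]
  have hs : 1 ≤ (v 1 + 1).toNat := by omega
  have hcast : (((v 1 + 1).toNat : ℕ) : ℝ) = (v 1 : ℝ) + 1 := by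
    have : (((v 1 + 1).toNat : ℕ) : ℤ) = v 1 + 1 := Int.toNat_of_nonneg (by omega)
    exact_mod_cast this
  have := hpK_le_inv hs (v 0)
  rw [hcast] at this
  exact this

end HalfPlaneKernelUniform



section Bridge

/-- The two lattice Laplacians of the tree agree on `ℤ²` (private copy of
`latticeLaplacian_eq_latticeLaplacianZd` of `HarmonicFlatBoundaryRow.lean`, kept local to stay out
of that file's import cone). [folklore] -/
private theorem latticeLaplacian_eq_zd (H : Site 2 → ℝ) (v : Site 2) :
    latticeLaplacian H v = latticeLaplacianZd H v := by
  rw [latticeLaplacian, Fin.sum_univ_four, latticeLaplacianZd_def, Fin.sum_univ_two]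
  simp only [cornerUnit, ← sub_eq_add_neg]
  push_cast
  ring

end Bridge

section GreenPole

variable {Λ : Finset (Site 2)} {b : Site 2}

/-- The lattice Laplacian of `G_Λ(b, ·)` on `Λ`: `Δ G_Λ(b,·)(z) = -[b = z]` (Poisson equation,
`DirichletGreenFunction.neg_latticeLaplacianZd_dirichletGreen`, on `ℤ²`). [folklore] -/
theorem latticeLaplacian_dirichletGreen (Λ : Finset (Site 2)) (b : Site 2) {z : Site 2} (hz : z ∈ Λ) :
    latticeLaplacian (dirichletGreen Λ b) z = -(if b = z then 1 else 0) := by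
  rw [latticeLaplacian_eq_zd, ← neg_latticeLaplacianZd_dirichletGreen two_pos Λ b hz,
    neg_neg]

/-- `G_Λ(b, ·)` is lattice-harmonic on `Λ ∖ {b}`. [folklore] -/
theorem isLatticeHarmonicOn_dirichletGreen (Λ : Finset (Site 2)) (b : Site 2) :
    IsLatticeHarmonicOn (dirichletGreen Λ b) ((↑Λ : Set (Site 2)) \ {b}) := by
  intro z hz
  rw [latticeLaplacian_dirichletGreen Λ b (Finset.mem_coe.1 hz.1), if_neg, neg_zero]
  exact fun h => hz.2 (h ▸ rfl)

end GreenPole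

section Window

open Real

variable {Λ : Finset (Site 2)} {b : Site 2} {W : ℕ}

/-- The shifted half-plane kernel with pole data at `b - e₁`: `P_b(z) = hpPoisson (z - b)`, so that
`P_b = δ_{b - e₁}` on the row below `b` and `P_b` is lattice-harmonic on the rows `≥ b₁`.
[folklore] -/
def polePoisson (b : Site 2) (z : Site 2) : ℝ := hpPoisson (z - b)

/-- `P_b ≥ 0`. [folklore] -/
theorem polePoisson_nonneg (b z : Site 2) : 0 ≤ polePoisson b z := hpPoisson_nonneg _

/-- `P_b` is lattice-harmonic at every `z` with `z₁ ≥ b₁`. [folklore] -/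
theorem latticeLaplacian_polePoisson (b : Site 2) {z : Site 2} (hz : b 1 ≤ z 1) :
    latticeLaplacian (polePoisson b) z = 0 := by
  have hσ : IsLatticeMotion (fun y : Site 2 => y - b) :=
    ⟨Equiv.refl _, fun y k => by simp [sub_add_eq_add_sub]⟩
  rw [show polePoisson b = fun y => hpPoisson (y - b) from rfl, hσ.latticeLaplacian_comp hpPoisson z]
  exact latticeLaplacian_hpPoisson (by simp only [Pi.sub_apply]; omega)

/-- On the row below `b`, `P_b = δ_{b - e₁}`. [folklore] -/
theorem polePoisson_row (b : Site 2) {z : Site 2} (hz : z 1 = b 1 - 1) :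
    polePoisson b z = if z 0 = b 0 then 1 else 0 := by
  rw [polePoisson, hpPoisson_row_neg_one (z - b) (by simp only [Pi.sub_apply]; omega)]
  simp only [Pi.sub_apply, sub_eq_zero]

/-- `P_b(z) ≤ 1/(π c₀ (z₁ - b₁ + 1))` above the row of `b`. [folklore] -/
theorem polePoisson_le_inv (b : Site 2) {z : Site 2} (hz : b 1 ≤ z 1) :
    polePoisson b z ≤ 1 / (π * modeRateConst * ((z 1 : ℝ) - b 1 + 1)) := by
  have h := hpPoisson_le_inv (z - b) (by simp only [Pi.sub_apply]; omega)
  simp only [Pi.sub_apply, Int.cast_sub] at h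
  exact h

/-- `P_b(z) ≤ 2 (z₁ - b₁ + 1)/(π (z₀ - b₀)²)` off the column of `b`, for `z₁ ≥ b₁ - 1`. [folklore] -/
theorem polePoisson_le_decay (b : Site 2) {z : Site 2} (h0 : z 0 ≠ b 0) (h1 : b 1 - 1 ≤ z 1) :
    polePoisson b z ≤ 2 * ((z 1 : ℝ) - b 1 + 1) / (π * ((z 0 : ℝ) - b 0) ^ 2) := by
  have h := hpPoisson_le (z - b) (by simp only [Pi.sub_apply]; omega) (by simp only [Pi.sub_apply]; omega)
  simp only [Pi.sub_apply, Int.cast_sub] at h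
  exact h

/-- **The Green function with its pole lifted to the boundary row is harmonic at the pole.**
If `b ∈ Λ` and `b - e₁ ∉ Λ`, then `Ĝ = G_Λ(b, ·) + 1_{b - e₁}` is lattice-harmonic at every
`z ∈ Λ` with `z₁ ≥ b₁` (at `z = b` the Poisson equation `Δ G_Λ(b,·)(b) = -1` is balanced by the
new neighbour value `1`; the other sites of `Λ` on the rows `≥ b₁` do not see `b - e₁`).
[folklore] -/
theorem latticeLaplacian_dirichletGreen_add_indicator (Λ : Finset (Site 2)) (b : Site 2)
    {z : Site 2} (hz : z ∈ Λ) (hz1 : b 1 ≤ z 1) :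
    latticeLaplacian (fun w => dirichletGreen Λ b w + if w = b - cornerUnit 1 then 1 else 0) z = 0 := by
  rw [show (fun w => dirichletGreen Λ b w + if w = b - cornerUnit 1 then (1 : ℝ) else 0) =
      dirichletGreen Λ b + (fun w => if w = b - cornerUnit 1 then (1 : ℝ) else 0) from rfl,
    latticeLaplacian_add, latticeLaplacian_dirichletGreen Λ b hz, latticeLaplacian_eq, Fin.sum_univ_four]
  have hz' : z ≠ b - cornerUnit 1 := by
    intro h
    have := congrArg (fun x : Site 2 => x 1) h
    simp [cornerUnit] at this
    omega
  have h0 : z + cornerUnit 0 ≠ b - cornerUnit 1 := by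
    intro h
    have := congrArg (fun x : Site 2 => x 1) h
    simp [cornerUnit] at this
    omega
  have h1 : z + cornerUnit 1 ≠ b - cornerUnit 1 := by
    intro h
    have := congrArg (fun x : Site 2 => x 1) h
    simp [cornerUnit] at this
    omega
  have h2 : z + cornerUnit 2 ≠ b - cornerUnit 1 := by
    intro h
    have := congrArg (fun x : Site 2 => x 1) h
    simp [cornerUnit] at this
    omega
  have h3 : (z + cornerUnit 3 = b - cornerUnit 1) ↔ b = z := by
    constructor
    · intro h
      have e0 := congrArg (fun x : Site 2 => x 0) h
      have e1 := congrArg (fun x : Site 2 => x 1) h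
      simp [cornerUnit] at e0 e1
      ext i; fin_cases i
      · exact e0.symm
      · simp; omega
    · rintro rfl
      ext i; fin_cases i <;> simp [cornerUnit, sub_eq_add_neg]
  simp only [if_neg hz', if_neg h0, if_neg h1, if_neg h2]
  by_cases hbz : b = z
  · rw [if_pos hbz, if_pos (h3.2 hbz)]; ring
  · rw [if_neg hbz, if_neg (fun h => hbz (h3.1 h))]; ring

/-- **Window comparison (upper).** Let `b ∈ Λ` sit on a flat stretch of the boundary of `Λ`:
inside the window `|z₀ - b₀| ≤ W`, `|z₁ - b₁| ≤ W` membership in `Λ` is `z₁ ≥ b₁`. If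
`G_Λ(b, ·) ≤ M` on the top side and the two vertical sides of the lattice rectangle
`R = (b₀ - W, b₀ + W) × (b₁ - 1, b₁ - 1 + W)`, then on `R`
`G_Λ(b, z) ≤ P_b(z) + M (ω_U(z) + ω_V(z))`
(`Ĝ - P_b` is harmonic on `R`, vanishes on the base row and is `≤ M` on the other sides;
`le_sides_latticeHM`). This replaces, for a pole at a flat boundary point of `ℤ²`, the appeal to
Theorem 3.8 in the a priori bound of Chelkak–Smirnov's proof of Theorem 3.13.
[cite: ChelkakSmirnov2011, proof of Thm. 3.13 (a priori bounds)] -/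
theorem dirichletGreen_le_polePoisson_add (hW : 1 ≤ W)
    (hflat : ∀ z : Site 2, |z 0 - b 0| ≤ W → |z 1 - b 1| ≤ W → (z ∈ Λ ↔ b 1 ≤ z 1))
    {M : ℝ}
    (hMU : ∀ w : Site 2, w 1 = b 1 - 1 + W → |w 0 - b 0| < W → dirichletGreen Λ b w ≤ M)
    (hMV : ∀ w : Site 2, |w 0 - b 0| = W → b 1 ≤ w 1 → w 1 < b 1 - 1 + W → dirichletGreen Λ b w ≤ M)
    {z : Site 2} (hz : z ∈ rectInterior ![b 0 - W, b 1 - 1] (2 * W) W) :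
    dirichletGreen Λ b z ≤ polePoisson b z +
      M * (latticeHM (rectInterior ![b 0 - W, b 1 - 1] (2 * W) W)
              {w : Site 2 | w 1 = (![b 0 - W, b 1 - 1] : Site 2) 1 + W} z +
           latticeHM (rectInterior ![b 0 - W, b 1 - 1] (2 * W) W)
              {w : Site 2 | w 0 = (![b 0 - W, b 1 - 1] : Site 2) 0 ∨
                w 0 = (![b 0 - W, b 1 - 1] : Site 2) 0 + 2 * W} z) := by
  set a : Site 2 := ![b 0 - W, b 1 - 1] with ha
  have ha0 : a 0 = b 0 - W := by simp [ha]
  have ha1 : a 1 = b 1 - 1 := by simp [ha]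
  set Q : Site 2 → ℝ := fun w =>
    (dirichletGreen Λ b w + if w = b - cornerUnit 1 then 1 else 0) - polePoisson b w with hQ
  -- `Q` is harmonic on the rectangle
  have hQharm : IsLatticeHarmonicOn Q (rectInterior a (2 * W) W) := by
    intro w hw
    simp only [rectInterior, mem_setOf_eq, ha0, ha1] at hw
    push_cast at hw
    have hwΛ : w ∈ Λ := (hflat w (by rw [abs_le]; constructor <;> omega)
      (by rw [abs_le]; constructor <;> omega)).2 (by omega)
    rw [hQ, show (fun w => (dirichletGreen Λ b w + if w = b - cornerUnit 1 then (1 : ℝ) else 0) -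
        polePoisson b w) = (fun w => dirichletGreen Λ b w + if w = b - cornerUnit 1 then (1 : ℝ) else 0) -
        polePoisson b from rfl, latticeLaplacian_sub,
      latticeLaplacian_dirichletGreen_add_indicator Λ b hwΛ (by omega),
      latticeLaplacian_polePoisson b (by omega), sub_zero]
  have hW0 : 0 < W := hW
  have key := le_sides_latticeHM (a := a) (S := W) (T := W) hW0 hQharm (MU := M) (MV := M) (ML := 0)
    ?_ ?_ ?_ hz
  · -- unpack at `z`: `z ≠ b - e₁`
    have hz' : z ≠ b - cornerUnit 1 := by
      intro h
      have := congrArg (fun x : Site 2 => x 1) h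
      simp only [rectInterior, mem_setOf_eq, ha1] at hz
      simp [cornerUnit] at this
      omega
    simp only [hQ, if_neg hz', add_zero, zero_mul, add_zero] at key
    linarith [key]
  · -- top side
    intro w hw1 hw0 hw0'
    rw [ha1] at hw1; rw [ha0] at hw0 hw0'
    have hne : w ≠ b - cornerUnit 1 := by
      intro h
      have := congrArg (fun x : Site 2 => x 1) h
      simp [cornerUnit] at this
      omega
    simp only [hQ, if_neg hne, add_zero]
    have := hMU w hw1 (by rw [abs_lt]; constructor <;> omega)
    linarith [polePoisson_nonneg b w]
  · -- vertical sides
    intro w hw0 hw1 hw1'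
    rw [ha0] at hw0; rw [ha1] at hw1 hw1'
    have hne : w ≠ b - cornerUnit 1 := by
      intro h
      have := congrArg (fun x : Site 2 => x 1) h
      simp [cornerUnit] at this
      omega
    simp only [hQ, if_neg hne, add_zero]
    have := hMV w (by rw [abs_eq (by positivity)]; omega) (by omega) (by omega)
    linarith [polePoisson_nonneg b w]
  · -- base row: `G = 0`, indicator `= δ`, `P_b = δ`
    intro w hw1 hw0 hw0'
    rw [ha1] at hw1; rw [ha0] at hw0 hw0'
    have hwΛ : w ∉ Λ := fun h =>
      absurd ((hflat w (by rw [abs_le]; constructor <;> omega) (by rw [abs_le]; constructor <;> omega)).1 h)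
        (by omega)
    have hind : (if w = b - cornerUnit 1 then (1 : ℝ) else 0) = if w 0 = b 0 then 1 else 0 := by
      by_cases h : w 0 = b 0
      · rw [if_pos h, if_pos]
        ext i; fin_cases i
        · simpa [cornerUnit] using h
        · simp [cornerUnit]; omega
      · rw [if_neg h, if_neg]
        intro h'
        exact h (by have := congrArg (fun x : Site 2 => x 0) h'; simpa [cornerUnit] using this)
    simp only [hQ, dirichletGreen_of_not_mem_right Λ b hwΛ, zero_add, hind, polePoisson_row b hw1,
      sub_self, le_refl]

end Window

section Bootstrap

open Real WeakBeurling

variable {Λ : Finset (Site 2)} {b : Site 2} {W ρ : ℕ}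

/-- The constant of the flat-pole a priori bound: `2 (1/(π c₀) + 8/π)`. [folklore] -/
def flatPoleConst : ℝ := 2 * (1 / (π * modeRateConst) + 8 / π)

/-- `flatPoleConst > 0`. [folklore] -/
theorem flatPoleConst_pos : 0 < flatPoleConst := by
  unfold flatPoleConst
  have := modeRateConst_pos
  positivity

/-- `P_b` on the sup-sphere of radius `ρ - 1` about `b` (rows `≥ b₁`): `P_b ≤ (1/(π c₀) + 8/π)/ρ`
for `ρ ≥ 2` (uniform bound on the top row, decay bound on the two columns). [folklore] -/
theorem polePoisson_le_sphere (hρ : 2 ≤ ρ) {z : Site 2} (hz1 : b 1 ≤ z 1)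
    (hz1' : z 1 - b 1 ≤ (ρ : ℤ) - 1) (hsph : |z 0 - b 0| = (ρ : ℤ) - 1 ∨ z 1 - b 1 = (ρ : ℤ) - 1) :
    polePoisson b z ≤ (1 / (π * modeRateConst) + 8 / π) / ρ := by
  have hρr : (2 : ℝ) ≤ ρ := by exact_mod_cast hρ
  have hc0 := modeRateConst_pos
  have hπc : 0 < 1 / (π * modeRateConst) := by positivity
  rcases hsph with h0 | h1
  · -- on a column: `|m| = ρ - 1 ≥ 1`
    have hm : z 0 ≠ b 0 := by
      intro h; rw [h, sub_self, abs_zero] at h0; omega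
    have hd := polePoisson_le_decay b hm (by omega)
    have hm2z : (z 0 - b 0) ^ 2 = ((ρ : ℤ) - 1) ^ 2 := by rw [← sq_abs, h0]
    have hm2 : ((z 0 : ℝ) - b 0) ^ 2 = ((ρ : ℝ) - 1) ^ 2 := by exact_mod_cast hm2z
    have hnum : (z 1 : ℝ) - b 1 + 1 ≤ ρ := by
      have := (Int.cast_le (R := ℝ)).2 hz1'
      push_cast at this
      linarith
    have hρ1 : (0 : ℝ) < (ρ : ℝ) - 1 := by linarith
    calc polePoisson b z ≤ 2 * ((z 1 : ℝ) - b 1 + 1) / (π * ((ρ : ℝ) - 1) ^ 2) := by rwa [hm2] at hd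
      _ ≤ 2 * (ρ : ℝ) / (π * ((ρ : ℝ) - 1) ^ 2) := by gcongr
      _ ≤ 8 / π / ρ := by
          rw [div_le_div_iff₀ (by positivity) (by positivity)]
          have e : 8 / π * (π * ((ρ : ℝ) - 1) ^ 2) = 8 * ((ρ : ℝ) - 1) ^ 2 := by field_simp
          rw [e]
          nlinarith
      _ ≤ (1 / (π * modeRateConst) + 8 / π) / ρ := by gcongr; linarith
  · -- on the top row: `h = ρ - 1`
    have hu := polePoisson_le_inv b hz1
    have hh : (z 1 : ℝ) - b 1 + 1 = ρ := by
      have := (Int.cast_inj (α := ℝ)).2 h1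
      push_cast at this
      linarith
    rw [hh] at hu
    calc polePoisson b z ≤ 1 / (π * modeRateConst * ρ) := hu
      _ = 1 / (π * modeRateConst) / ρ := by rw [div_div]
      _ ≤ (1 / (π * modeRateConst) + 8 / π) / ρ := by gcongr; linarith [show (0:ℝ) < 8 / π by positivity]

/-- **The two side harmonic measures are small low in the middle of the rectangle.** In the
rectangle `(a₀, a₀+2W) × (a₁, a₁+W)` with `W ≥ 8ρ`, at a point `w` with `|w₀ - a₀ - W| ≤ ρ` and
`w₁ - a₁ ≤ ρ` one has `ω_U(w) + ω_V(w) ≤ 1/2` (from `ω_U ≤ h₂`, `ω_V ≤ h₃`: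
`W³ ω_U ≤ 2W²ρ + Wρ² ≤ (17/64) W³`, `W² ω_V ≤ ρ² + ρW ≤ (9/64) W²`).
[cite: ChelkakSmirnov2011, Lemma 3.12] -/
theorem sides_latticeHM_le_half (a : Site 2) (hW : 0 < W) (hWρ : 8 * ρ ≤ W) {w : Site 2}
    (hw : w ∈ rectInterior a (2 * W) W) (hX : |w 0 - a 0 - W| ≤ ρ) (hY : w 1 - a 1 ≤ ρ) :
    latticeHM (rectInterior a (2 * W) W) {v : Site 2 | v 1 = a 1 + W} w +
      latticeHM (rectInterior a (2 * W) W) {v : Site 2 | v 0 = a 0 ∨ v 0 = a 0 + 2 * W} w ≤ 1 / 2 := by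
  have hU := le_csTopUpperNum (a := a) (S := W) (T := W) hW hw
  have hV := le_csSideUpperNum (a := a) (S := W) (T := W) hW hw
  set ωU := latticeHM (rectInterior a (2 * W) W) {v : Site 2 | v 1 = a 1 + W} w with hωU
  set ωV := latticeHM (rectInterior a (2 * W) W) {v : Site 2 | v 0 = a 0 ∨ v 0 = a 0 + 2 * W} w
    with hωV
  simp only [csTopUpperNum, csSideUpperNum] at hU hV
  set X : ℝ := (w 0 : ℝ) - a 0 - W with hXdef
  set Y : ℝ := (w 1 : ℝ) - a 1 with hYdef
  have hW0 : (0 : ℝ) < W := by exact_mod_cast hW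
  have hWr : 8 * (ρ : ℝ) ≤ W := by exact_mod_cast hWρ
  have hρ0 : (0 : ℝ) ≤ ρ := by positivity
  have hY0 : 0 < Y := by
    have h := hw.2.2.1
    have := (Int.cast_lt (R := ℝ)).2 h
    rw [hYdef]; linarith
  have hYρ : Y ≤ ρ := by
    have := (Int.cast_le (R := ℝ)).2 hY
    push_cast at this
    rw [hYdef]; linarith
  have hX2 : X ^ 2 ≤ (ρ : ℝ) ^ 2 := by
    have h1 : (w 0 - a 0 - W) ^ 2 ≤ (ρ : ℤ) ^ 2 := by
      rw [← sq_abs]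
      have h0 : 0 ≤ |w 0 - a 0 - W| := abs_nonneg _
      nlinarith [hX, h0]
    have h2 := (Int.cast_le (R := ℝ)).2 h1
    push_cast at h2
    rw [hXdef]; exact h2
  have hX2' : X ^ 2 ≤ (W : ℝ) ^ 2 / 64 := by nlinarith [hX2, hWr, hρ0]
  have hYW : Y ≤ (W : ℝ) / 8 := by linarith
  have h1 : (W : ℝ) ^ 2 * W * ωU ≤ (W : ℝ) ^ 3 * (17 / 64) :=
    calc (W : ℝ) ^ 2 * W * ωU ≤ ((W : ℝ) ^ 2 + (W : ℝ) ^ 2) * Y + W * (X ^ 2 - Y ^ 2) := hU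
      _ ≤ 2 * (W : ℝ) ^ 2 * Y + W * X ^ 2 := by nlinarith [sq_nonneg Y, hW0]
      _ ≤ 2 * (W : ℝ) ^ 2 * ((W : ℝ) / 8) + W * ((W : ℝ) ^ 2 / 64) := by gcongr
      _ = (W : ℝ) ^ 3 * (17 / 64) := by ring
  have h2 : (W : ℝ) ^ 2 * ωV ≤ (W : ℝ) ^ 2 * (9 / 64) :=
    calc (W : ℝ) ^ 2 * ωV ≤ X ^ 2 + Y * ((W : ℝ) - Y) := hV
      _ ≤ X ^ 2 + Y * W := by nlinarith [sq_nonneg Y, hY0]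
      _ ≤ (W : ℝ) ^ 2 / 64 + (W : ℝ) / 8 * W := by gcongr
      _ = (W : ℝ) ^ 2 * (9 / 64) := by ring
  have hW3 : (0 : ℝ) < (W : ℝ) ^ 2 * W := by positivity
  have hW2 : (0 : ℝ) < (W : ℝ) ^ 2 := by positivity
  have h1' : ωU ≤ 17 / 64 := by
    by_contra hcon
    push Not at hcon
    have := mul_lt_mul_of_pos_left hcon hW3
    linarith [h1, show (W : ℝ) ^ 2 * W * (17 / 64) = (W : ℝ) ^ 3 * (17 / 64) by ring]
  have h2' : ωV ≤ 9 / 64 := by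
    by_contra hcon
    push Not at hcon
    have := mul_lt_mul_of_pos_left hcon hW2
    linarith [h2]
  linarith

/-- **A priori bound for the Green function with a pole next to a flat boundary stretch**
(square-lattice substitute for the a priori bound `M_{3d} ≤ const(d)` in Chelkak–Smirnov's proof of
Theorems 3.10/3.13, for a pole at a flat boundary point). Let `Λ ⊆ ℤ²` be finite and `b ∈ Λ` such
that in the window `|z₀ - b₀| ≤ W`, `|z₁ - b₁| ≤ W` membership in `Λ` is exactly `z₁ ≥ b₁` (so `b`
sits on the row above a straight piece of killed boundary of length `2W + 1`). Then for
`2 ≤ ρ`, `8ρ ≤ W` and every `z ∈ Λ` at sup-distance `≥ ρ` from `b`,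
`G_Λ(b, z) ≤ flatPoleConst / ρ`.
Proof: the maximum `F*` of `G_Λ(b,·)` over these `z` is attained, by the maximum principle, next to
the sup-sphere of radius `ρ - 1`, where the window comparison gives
`G ≤ P_b + F* (ω_U + ω_V) ≤ C₁/ρ + F*/2` (half-plane kernel bounds and the barriers of
Chelkak–Smirnov's Lemma 3.12). [cite: ChelkakSmirnov2011, proof of Thm. 3.13 (a priori bounds)] -/
theorem dirichletGreen_le_flatPoleConst_div (hρ : 2 ≤ ρ) (hWρ : 8 * ρ ≤ W)
    (hflat : ∀ z : Site 2, |z 0 - b 0| ≤ W → |z 1 - b 1| ≤ W → (z ∈ Λ ↔ b 1 ≤ z 1))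
    {z : Site 2} (hz : z ∈ Λ) (hfar : (ρ : ℤ) ≤ |z 0 - b 0| ∨ (ρ : ℤ) ≤ |z 1 - b 1|) :
    dirichletGreen Λ b z ≤ flatPoleConst / ρ := by
  classical
  set F : Site 2 → ℝ := dirichletGreen Λ b with hF
  set A : Set (Site 2) := {v | v ∈ Λ ∧ ((ρ : ℤ) ≤ |v 0 - b 0| ∨ (ρ : ℤ) ≤ |v 1 - b 1|)} with hA
  have hAfin : A.Finite := Λ.finite_toSet.subset fun v hv => hv.1
  have hzA : z ∈ A := ⟨hz, hfar⟩
  obtain ⟨zm, hzmA, hmax⟩ := Set.exists_max_image A F hAfin ⟨z, hzA⟩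
  have hFm0 : 0 ≤ F zm := dirichletGreen_nonneg two_pos Λ b zm
  have hρr : (2 : ℝ) ≤ ρ := by exact_mod_cast hρ
  have hρ0 : (0 : ℝ) < ρ := by linarith
  have hc0 := modeRateConst_pos
  set C₁ : ℝ := 1 / (π * modeRateConst) + 8 / π with hC₁
  have hC₁0 : 0 < C₁ := by positivity
  -- it suffices to bound the maximum by `C₁/ρ + F*/2`
  suffices hkey : F zm ≤ C₁ / ρ + F zm / 2 by
    have h2 : F zm ≤ flatPoleConst / ρ := by
      rw [show flatPoleConst = 2 * C₁ from rfl, mul_div_assoc]; linarith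
    exact (hmax z hzA).trans h2
  -- `F` is harmonic on `A` (`b ∉ A`)
  have hbA : b ∉ A := by
    rintro ⟨-, h⟩
    simp only [sub_self, abs_zero] at h
    omega
  have hsub : IsLatticeSubharmonicOn F A := fun v hv =>
    (isLatticeHarmonicOn_dirichletGreen Λ b v ⟨Finset.mem_coe.2 hv.1, fun h => hbA (by
      rw [Set.mem_singleton_iff] at h; rw [h] at hv; exact hv)⟩).ge
  refine hsub.le_of_forall_boundary_le hAfin (fun w hw => ?_) zm hzmA
  obtain ⟨hwA, v, hvA, k, rfl⟩ := hw
  by_cases hwΛ : v + cornerUnit k ∈ Λ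
  swap
  · rw [hF, dirichletGreen_of_not_mem_right Λ b hwΛ]; positivity
  -- `w ∈ Λ ∖ A` next to `A`: on the sup-sphere of radius `ρ - 1`, above the row of `b`
  have hnf : |(v + cornerUnit k) 0 - b 0| < ρ ∧ |(v + cornerUnit k) 1 - b 1| < ρ := by
    by_contra h
    rw [not_and_or, not_lt, not_lt] at h
    exact hwA ⟨hwΛ, h⟩
  have hst := coord_step_of_stepKind (stepKind_add_cornerUnit v k)
  have hvfar := hvA.2
  set w := v + cornerUnit k with hw
  have hW1 : (ρ : ℤ) ≤ W := by omega
  have hwb1 : b 1 ≤ w 1 := (hflat w (by omega) (by omega)).1 hwΛ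
  have hlt0 := hnf.1
  have hlt1 := hnf.2
  rw [abs_lt] at hlt0 hlt1
  have habs0 : |w 0 - b 0| ≤ (ρ : ℤ) - 1 := by rw [abs_le]; omega
  have hh : w 1 - b 1 ≤ (ρ : ℤ) - 1 := by omega
  have hsph : |w 0 - b 0| = (ρ : ℤ) - 1 ∨ w 1 - b 1 = (ρ : ℤ) - 1 := by
    rw [le_abs, le_abs] at hvfar
    rw [abs_eq (by omega : (0 : ℤ) ≤ (ρ : ℤ) - 1)]
    omega
  -- `w` lies in the window rectangle
  have hwR : w ∈ rectInterior ![b 0 - W, b 1 - 1] (2 * W) W := by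
    simp only [rectInterior, mem_setOf_eq, Matrix.cons_val_zero, Matrix.cons_val_one]
    push_cast
    omega
  -- the far sides of the window lie in `A ∪ Λᶜ`, where `F ≤ F zm`
  have hfarside : ∀ w' : Site 2, ((ρ : ℤ) ≤ |w' 0 - b 0| ∨ (ρ : ℤ) ≤ |w' 1 - b 1|) → F w' ≤ F zm := by
    intro w' hw'
    by_cases hw'Λ : w' ∈ Λ
    · exact hmax w' ⟨hw'Λ, hw'⟩
    · rw [hF, dirichletGreen_of_not_mem_right Λ b hw'Λ]; exact hFm0
  have hcmp := dirichletGreen_le_polePoisson_add (Λ := Λ) (b := b) (W := W) (by omega) hflat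
    (M := F zm) (fun w' hw'1 _ => hfarside w' (Or.inr (by rw [hw'1, le_abs]; left; omega)))
    (fun w' hw'0 _ _ => hfarside w' (Or.inl (by rw [hw'0]; exact hW1))) hwR
  -- the two harmonic measures at `w` add up to at most `1/2`
  have hT0 : 0 < W := by omega
  have hside := sides_latticeHM_le_half (ρ := ρ) (![b 0 - (W : ℤ), b 1 - 1]) hT0 hWρ hwR
    (by
      simp only [Matrix.cons_val_zero]
      rw [show w 0 - (b 0 - (W : ℤ)) - W = w 0 - b 0 by ring]
      exact habs0.trans (by omega))
    (by
      simp only [Matrix.cons_val_one, Matrix.cons_val_zero]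
      omega)
  -- assemble
  have hP := polePoisson_le_sphere (b := b) hρ hwb1 hh hsph
  calc F w ≤ polePoisson b w + F zm * _ := hcmp
    _ ≤ C₁ / ρ + F zm * (1 / 2) := add_le_add hP (mul_le_mul_of_nonneg_left hside hFm0)
    _ = C₁ / ρ + F zm / 2 := by ring

end Bootstrap

/-! ### Lower bounds: the lower window comparison -/

section LowerBound

open Real WeakBeurling

variable {Λ : Finset (Site 2)} {b : Site 2} {W : ℕ}

/-- The window rectangle of half-width `W` standing on the row below `b`, as a finite set:
the lattice points `|z₀ - b₀| < W`, `b₁ ≤ z₁ ≤ b₁ + W - 2`. [folklore] -/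
def windowFinset (b : Site 2) (W : ℕ) : Finset (Site 2) :=
  (rectInterior_finite ![b 0 - (W : ℤ), b 1 - 1] (2 * W) W).toFinset

/-- Membership in the window. [folklore] -/
theorem mem_windowFinset {b z : Site 2} {W : ℕ} :
    z ∈ windowFinset b W ↔ z ∈ rectInterior ![b 0 - (W : ℤ), b 1 - 1] (2 * W) W := by
  rw [windowFinset, Set.Finite.mem_toFinset]

/-- Coordinates of the window. [folklore] -/
theorem mem_windowFinset_iff {b z : Site 2} {W : ℕ} :
    z ∈ windowFinset b W ↔ |z 0 - b 0| < W ∧ b 1 ≤ z 1 ∧ z 1 < b 1 - 1 + W := by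
  rw [mem_windowFinset]
  simp only [rectInterior, mem_setOf_eq, Matrix.cons_val_zero, Matrix.cons_val_one, abs_lt]
  push_cast
  omega

/-- `ω_U + ω_V ≤ 1` on the rectangle (maximum principle; on the frame the two indicators never
overlap). [folklore] -/
theorem latticeHM_top_add_sides_le_one (a : Site 2) {S T : ℕ} (hT : 0 < T) {v : Site 2}
    (hv : v ∈ rectInterior a (2 * S) T) :
    latticeHM (rectInterior a (2 * S) T) {w : Site 2 | w 1 = a 1 + T} v +
      latticeHM (rectInterior a (2 * S) T) {w : Site 2 | w 0 = a 0 ∨ w 0 = a 0 + 2 * S} v ≤ 1 := by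
  have h := le_sides_latticeHM (a := a) (S := S) (T := T) hT (Q := fun _ => (1 : ℝ))
    (fun _ _ => latticeLaplacian_const 1 _) (MU := 1) (MV := 1) (ML := 1)
    (fun _ _ _ _ => le_rfl) (fun _ _ _ _ => le_rfl) (fun _ _ _ _ => le_rfl) hv
  -- the three harmonic measures are nonnegative and sum to at least one; each is at most one:
  -- use instead the maximum principle on `ω_U + ω_V` directly
  have hR := rectInterior_finite a (2 * S) T
  set U : Set (Site 2) := {w : Site 2 | w 1 = a 1 + T}
  set V : Set (Site 2) := {w : Site 2 | w 0 = a 0 ∨ w 0 = a 0 + 2 * S}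
  have hharm : IsLatticeHarmonicOn (fun w => latticeHM (rectInterior a (2 * S) T) U w +
      latticeHM (rectInterior a (2 * S) T) V w) (rectInterior a (2 * S) T) := by
    intro w hw
    rw [show (fun w => latticeHM (rectInterior a (2 * S) T) U w + latticeHM (rectInterior a (2 * S) T) V w)
      = latticeHM (rectInterior a (2 * S) T) U + latticeHM (rectInterior a (2 * S) T) V from rfl,
      latticeLaplacian_add, latticeHM_harmonicOn hR U w hw, latticeHM_harmonicOn hR V w hw, add_zero]
  refine hharm.subharmonicOn.le_of_forall_boundary_le hR (M := 1) (fun w hw => ?_) v hv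
  have hwR : w ∉ rectInterior a (2 * S) T := hw.1
  rcases frame_of_mem_latticeOuterBoundary hw with ⟨h0, h1, h2⟩ | ⟨h1 | h1, h0, h0'⟩
  · have hU : w ∉ U := by simp only [U, mem_setOf_eq]; omega
    rw [latticeHM_of_not_mem_of_not_mem hR hwR hU, zero_add]
    exact (latticeHM_mem_Icc hR V w).2
  · have hV : w ∉ V := by simp only [V, mem_setOf_eq]; omega
    rw [latticeHM_of_not_mem_of_not_mem hR hwR hV, add_zero]
    exact (latticeHM_mem_Icc hR U w).2
  · have hV : w ∉ V := by simp only [V, mem_setOf_eq]; omega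
    rw [latticeHM_of_not_mem_of_not_mem hR hwR hV, add_zero]
    exact (latticeHM_mem_Icc hR U w).2

/-- **Window comparison (lower).** On the window rectangle `R` (as the killed-outside domain
`windowFinset b W`), the Green function with pole `b` dominates the half-plane kernel up to the
latter's size on the far sides: if `P_b ≤ M'` on the top and vertical sides of `R`, then
`G_R(b, z) ≥ P_b(z) - M'` on `R` (`P_b - Ĝ_R` is harmonic on `R`, vanishes on the base row and is
`≤ M'` on the other sides). [cite: ChelkakSmirnov2011, proof of Thm. 3.13 (a priori bounds)] -/
theorem polePoisson_sub_le_dirichletGreen_window (hW : 2 ≤ W) {M' : ℝ}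
    (hMU : ∀ w : Site 2, w 1 = b 1 - 1 + W → |w 0 - b 0| < W → polePoisson b w ≤ M')
    (hMV : ∀ w : Site 2, |w 0 - b 0| = W → b 1 ≤ w 1 → w 1 < b 1 - 1 + W → polePoisson b w ≤ M')
    {z : Site 2} (hz : z ∈ rectInterior ![b 0 - (W : ℤ), b 1 - 1] (2 * W) W) :
    polePoisson b z - M' ≤ dirichletGreen (windowFinset b W) b z := by
  set a : Site 2 := ![b 0 - (W : ℤ), b 1 - 1] with ha
  have ha0 : a 0 = b 0 - W := by simp [ha]
  have ha1 : a 1 = b 1 - 1 := by simp [ha]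
  set RF := windowFinset b W with hRF
  set Q : Site 2 → ℝ := fun w =>
    polePoisson b w - (dirichletGreen RF b w + if w = b - cornerUnit 1 then 1 else 0) with hQ
  have hQharm : IsLatticeHarmonicOn Q (rectInterior a (2 * W) W) := by
    intro w hw
    have hwRF : w ∈ RF := mem_windowFinset.2 hw
    simp only [rectInterior, mem_setOf_eq, ha0, ha1] at hw
    push_cast at hw
    rw [hQ, show (fun w => polePoisson b w -
        (dirichletGreen RF b w + if w = b - cornerUnit 1 then (1 : ℝ) else 0)) =
        polePoisson b - (fun w => dirichletGreen RF b w + if w = b - cornerUnit 1 then (1 : ℝ) else 0)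
        from rfl, latticeLaplacian_sub, latticeLaplacian_polePoisson b (by omega),
      latticeLaplacian_dirichletGreen_add_indicator RF b hwRF (by omega), sub_zero]
  have hW0 : 0 < W := by omega
  have key := le_sides_latticeHM (a := a) (S := W) (T := W) hW0 hQharm (MU := M') (MV := M') (ML := 0)
    ?_ ?_ ?_ hz
  · have hz' : z ≠ b - cornerUnit 1 := by
      intro h
      have := congrArg (fun x : Site 2 => x 1) h
      simp only [rectInterior, mem_setOf_eq, ha1] at hz
      simp [cornerUnit] at this
      omega
    have hsum := latticeHM_top_add_sides_le_one a hW0 hz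
    have hM' : 0 ≤ M' := by
      -- `M'` bounds the nonnegative kernel at a point of the top side
      have := hMU ![b 0, b 1 - 1 + W] (by simp) (by simp; exact_mod_cast hW0)
      exact (polePoisson_nonneg b _).trans this
    simp only [hQ, if_neg hz', add_zero, zero_mul] at key
    nlinarith [key, hsum, hM', (latticeHM_mem_Icc (rectInterior_finite a (2 * W) W) {w : Site 2 | w 1 = a 1 + W} z).1,
      (latticeHM_mem_Icc (rectInterior_finite a (2 * W) W) {w : Site 2 | w 0 = a 0 ∨ w 0 = a 0 + 2 * W} z).1]
  · -- top side: `Q ≤ P_b ≤ M'`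
    intro w hw1 hw0 hw0'
    rw [ha1] at hw1; rw [ha0] at hw0 hw0'
    have hwRF : w ∉ RF := fun h => by
      have := (mem_windowFinset_iff.1 h).2.2; omega
    have hne : w ≠ b - cornerUnit 1 := by
      intro h
      have := congrArg (fun x : Site 2 => x 1) h
      simp [cornerUnit] at this
      omega
    simp only [hQ, if_neg hne, add_zero, dirichletGreen_of_not_mem_right RF b hwRF, sub_zero]
    exact hMU w hw1 (by rw [abs_lt]; constructor <;> omega)
  · -- vertical sides
    intro w hw0 hw1 hw1'
    rw [ha0] at hw0; rw [ha1] at hw1 hw1'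
    have hwRF : w ∉ RF := fun h => by
      have := (mem_windowFinset_iff.1 h).1; rw [abs_lt] at this; omega
    have hne : w ≠ b - cornerUnit 1 := by
      intro h
      have := congrArg (fun x : Site 2 => x 1) h
      simp [cornerUnit] at this
      omega
    simp only [hQ, if_neg hne, add_zero, dirichletGreen_of_not_mem_right RF b hwRF, sub_zero]
    exact hMV w (by rw [abs_eq (by positivity)]; omega) (by omega) (by omega)
  · -- base row: `Q = δ - (0 + δ) = 0`
    intro w hw1 hw0 hw0'
    rw [ha1] at hw1; rw [ha0] at hw0 hw0'
    have hwRF : w ∉ RF := fun h => by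
      have := (mem_windowFinset_iff.1 h).2.1; omega
    have hind : (if w = b - cornerUnit 1 then (1 : ℝ) else 0) = if w 0 = b 0 then 1 else 0 := by
      by_cases h : w 0 = b 0
      · rw [if_pos h, if_pos]
        ext i; fin_cases i
        · simpa [cornerUnit] using h
        · simp [cornerUnit]; omega
      · rw [if_neg h, if_neg]
        intro h'
        exact h (by have := congrArg (fun x : Site 2 => x 0) h'; simpa [cornerUnit] using this)
    simp only [hQ, dirichletGreen_of_not_mem_right RF b hwRF, zero_add, hind, polePoisson_row b hw1,
      sub_self, le_refl]

/-- The size of `P_b` on the far sides of the window of half-width `W`: at most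
`(1/(π c₀) + 2/π)/W`. [folklore] -/
theorem polePoisson_le_far (hW : 1 ≤ W) {w : Site 2}
    (hw : (w 1 = b 1 - 1 + W ∧ |w 0 - b 0| < W) ∨ (|w 0 - b 0| = W ∧ b 1 ≤ w 1 ∧ w 1 < b 1 - 1 + W)) :
    polePoisson b w ≤ (1 / (π * modeRateConst) + 2 / π) / W := by
  have hW0 : (0 : ℝ) < W := by exact_mod_cast hW
  have hc0 := modeRateConst_pos
  have h1 : 0 < 1 / (π * modeRateConst) := by positivity
  have h2 : 0 < 2 / π := by positivity
  rcases hw with ⟨hw1, _⟩ | ⟨hw0, hw1, hw1'⟩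
  · have hu := polePoisson_le_inv b (z := w) (by omega)
    have hh : (w 1 : ℝ) - b 1 + 1 = W := by
      have := (Int.cast_inj (α := ℝ)).2 hw1; push_cast at this; linarith
    rw [hh] at hu
    calc polePoisson b w ≤ 1 / (π * modeRateConst * W) := hu
      _ = 1 / (π * modeRateConst) / W := by rw [div_div]
      _ ≤ (1 / (π * modeRateConst) + 2 / π) / W := by gcongr; linarith
  · have hm : w 0 ≠ b 0 := by intro h; rw [h, sub_self, abs_zero] at hw0; omega
    have hd := polePoisson_le_decay b hm (by omega)
    have hm2z : (w 0 - b 0) ^ 2 = (W : ℤ) ^ 2 := by rw [← sq_abs, hw0]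
    have hm2 : ((w 0 : ℝ) - b 0) ^ 2 = (W : ℝ) ^ 2 := by exact_mod_cast hm2z
    have hnum : (w 1 : ℝ) - b 1 + 1 ≤ W := by
      have : w 1 - b 1 + 1 ≤ (W : ℤ) := by omega
      have := (Int.cast_le (R := ℝ)).2 this; push_cast at this; linarith
    calc polePoisson b w ≤ 2 * ((w 1 : ℝ) - b 1 + 1) / (π * (W : ℝ) ^ 2) := by rwa [hm2] at hd
      _ ≤ 2 * (W : ℝ) / (π * (W : ℝ) ^ 2) := by gcongr
      _ = 2 / π / W := by field_simp
      _ ≤ (1 / (π * modeRateConst) + 2 / π) / W := by gcongr; linarith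

/-- **Lower bound on the axis above the pole.** If `Λ` contains the window rows `≥ b₁`
(half-width `W`) then at the point `T_b = (b₀, b₁ + t - 1)`, `1 ≤ t`, `t + 1 ≤ W`,
`G_Λ(b, T_b) ≥ 1/(4t) - (1/(π c₀) + 2/π)/W` (monotonicity `G_Λ ≥ G_window`, the lower window
comparison and `K_t(0) ≥ 1/(4t)`); in particular `≥ 1/(8t)` once `W ≥ 8 (1/(π c₀) + 2/π) t`.
[cite: ChelkakSmirnov2011, proof of Thm. 3.13 (a priori bounds)] -/
theorem dirichletGreen_axis_ge (hW : 2 ≤ W) (hsub : windowFinset b W ⊆ Λ) {t : ℕ} (ht : 1 ≤ t)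
    (htW : t + 1 ≤ W) {z : Site 2} (hz0 : z 0 = b 0) (hz1 : z 1 = b 1 + t - 1) :
    1 / (4 * (t : ℝ)) - (1 / (π * modeRateConst) + 2 / π) / W ≤ dirichletGreen Λ b z := by
  have hzR : z ∈ rectInterior ![b 0 - (W : ℤ), b 1 - 1] (2 * W) W := by
    simp only [rectInterior, mem_setOf_eq, Matrix.cons_val_zero, Matrix.cons_val_one]
    push_cast
    omega
  have hwin := polePoisson_sub_le_dirichletGreen_window (b := b) hW
    (M' := (1 / (π * modeRateConst) + 2 / π) / W)
    (fun w hw1 hw0 => polePoisson_le_far (by omega) (Or.inl ⟨hw1, hw0⟩))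
    (fun w hw0 hw1 hw1' => polePoisson_le_far (by omega) (Or.inr ⟨hw0, hw1, hw1'⟩)) hzR
  have hmono := dirichletGreen_mono two_pos hsub b z
  have haxis : 1 / (4 * (t : ℝ)) ≤ polePoisson b z := by
    have h := hpPoisson_axis_ge (z - b) (by simp only [Pi.sub_apply]; omega) (by simp only [Pi.sub_apply]; omega)
    simp only [Pi.sub_apply, Int.cast_sub] at h
    have ht' : ((z 1 : ℝ) - b 1) + 1 = t := by
      have : z 1 - b 1 + 1 = (t : ℤ) := by omega
      have := (Int.cast_inj (α := ℝ)).2 this; push_cast at this; linarith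
    rw [ht'] at h
    exact h
  linarith [hwin, hmono, haxis]

end LowerBound

/-! ### Transport through the bulk: Harnack chains on boxes, and the value next to the base -/

section Corridor

open Real

/-- The second coordinate is unchanged along an eastward run. [folklore] -/
theorem add_nsmul_cornerUnit_zero_apply_one (v : Site 2) (n : ℕ) :
    (v + n • cornerUnit 0) 1 = v 1 := by
  simp [cornerUnit]

/-- A straight run of face steps outside `P`: eastwards. [folklore] -/
theorem reflTransGen_faceStep_east {P : Set (Site 2)} {g : Site 2} {K : ℕ}
    (h : ∀ j : ℕ, j ≤ K → g + j • cornerUnit 0 ∉ P) :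
    Relation.ReflTransGen (FaceStep P) g (g + K • cornerUnit 0) := by
  induction K with
  | zero => rw [zero_nsmul, add_zero]
  | succ K ih =>
    refine (ih fun j hj => h j (by omega)).tail ⟨?_, h K (by omega), ?_⟩
    · rw [succ_nsmul, ← add_assoc]
      exact (SimpleGraph.mem_edgeSet _).1 (cSrc_mem_edgeSet (g + K • cornerUnit 0, 0))
    · exact h (K + 1) le_rfl

/-- A straight run of face steps outside `P`: upwards. [folklore] -/
theorem reflTransGen_faceStep_up {P : Set (Site 2)} {g : Site 2} {K : ℕ}
    (h : ∀ j : ℕ, j ≤ K → g + j • cornerUnit 1 ∉ P) :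
    Relation.ReflTransGen (FaceStep P) g (g + K • cornerUnit 1) := by
  induction K with
  | zero => rw [zero_nsmul, add_zero]
  | succ K ih =>
    refine (ih fun j hj => h j (by omega)).tail ⟨?_, h K (by omega), ?_⟩
    · rw [succ_nsmul, ← add_assoc]
      exact (SimpleGraph.mem_edgeSet _).1 (cSrc_mem_edgeSet (g + K • cornerUnit 1, 1))
    · exact h (K + 1) le_rfl

/-- **Closed square boxes are hole-free**: a face outside the box `{|x₀ - p₀| ≤ n, |x₁ - p₁| ≤ n}`
escapes upwards — straight up, unless it lies under the box, in which case it first runs east past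
the box. [folklore] -/
theorem holeFree_sqBox (p : Site 2) (n : ℤ) : HoleFree (WeakBeurling.sqBox p n) := by
  intro g hg M
  simp only [WeakBeurling.sqBox, Set.mem_setOf_eq, not_and_or, not_le] at hg
  -- a point whose column misses the box, or which lies above it, climbs straight up
  have climb : ∀ g' : Site 2, (n < |g' 0 - p 0| ∨ p 1 + n < g' 1) →
      ∃ g'', M ≤ g'' 1 ∧ Relation.ReflTransGen (FaceStep (WeakBeurling.sqBox p n)) g' g'' := by
    intro g' hg'
    obtain ⟨K, hK⟩ : ∃ K : ℕ, M ≤ g' 1 + K := ⟨(M - g' 1).toNat, by omega⟩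
    refine ⟨g' + K • cornerUnit 1, by rw [(nsmul_cornerUnit_one_apply g' K).2]; exact hK,
      reflTransGen_faceStep_up fun j _ hmem => ?_⟩
    obtain ⟨h0, h1⟩ := hmem
    rw [(nsmul_cornerUnit_one_apply g' j).1] at h0
    rw [(nsmul_cornerUnit_one_apply g' j).2, abs_le] at h1
    rcases hg' with hg' | hg'
    · exact absurd h0 (not_le.2 hg')
    · omega
  rcases hg with hg0 | hg1
  · exact climb g (Or.inl hg0)
  · -- the column meets the box: above it climb, below it run east first
    rw [lt_abs] at hg1
    rcases hg1 with hup | hdown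
    · exact climb g (Or.inr (by omega))
    · obtain ⟨K, hK⟩ : ∃ K : ℕ, p 0 + n < g 0 + K := ⟨(p 0 + n + 1 - g 0).toNat, by omega⟩
      have hrun : Relation.ReflTransGen (FaceStep (WeakBeurling.sqBox p n)) g (g + K • cornerUnit 0) := by
        refine reflTransGen_faceStep_east fun j _ hmem => ?_
        obtain ⟨-, h1⟩ := hmem
        rw [add_nsmul_cornerUnit_zero_apply_one, abs_le] at h1
        omega
      obtain ⟨g'', hM, hpath⟩ := climb (g + K • cornerUnit 0) (Or.inl (by
        rw [add_nsmul_cornerUnit_zero_apply, lt_abs]; left; omega))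
      exact ⟨g'', hM, hrun.trans hpath⟩

/-- **Harnack's inequality on a box** (one scale): a function lattice-harmonic on the box of
radius `48k` about `c` and nonnegative everywhere is at least `(c_*/2)` times its central value on
the box of radius `12k` (`harnack_one_scale` of `LatticeHarnackOneScale.lean`, boxes being
hole-free). [cite: LawlerSchrammWerner2004, Lemma 5.2] -/
theorem harnack_box {h : Site 2 → ℝ} (c : Site 2) {k : ℕ} (hk : 0 < k)
    (hh : IsLatticeHarmonicOn h (mW c k)) (hpos : ∀ w, 0 ≤ h w) {x : Site 2} (hx : x ∈ mB c k) :
    maneuverConst / 2 * h c ≤ h x :=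
  harnack_one_scale (mW_finite c k) (holeFree_sqBox c (48 * (k : ℤ))) hh
    (fun w _ => hpos w) hk subset_rfl hx

/-- **Harnack chain.** Along centres `c₀, c₁, …, c_J` with `c_{j+1}` in the small box about `c_j`
and `h` harmonic on each big box, `h(c_J) ≥ (c_*/2)^J h(c₀)`. [folklore] -/
theorem harnack_chain {h : Site 2 → ℝ} (hpos : ∀ w, 0 ≤ h w) {k : ℕ} (hk : 0 < k) (c : ℕ → Site 2) :
    ∀ J : ℕ, (∀ j, j ≤ J → IsLatticeHarmonicOn h (mW (c j) k)) → (∀ j, j < J → c (j + 1) ∈ mB (c j) k) →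
      (maneuverConst / 2) ^ J * h (c 0) ≤ h (c J) := by
  intro J
  induction J with
  | zero => intro _ _; simp
  | succ J ih =>
    intro hharm hstep
    have h1 := ih (fun j hj => hharm j (by omega)) (fun j hj => hstep j (by omega))
    have h2 := harnack_box (c J) hk (hharm J (by omega)) hpos (hstep J (by omega))
    have hc : 0 ≤ maneuverConst / 2 := by linarith [maneuverConst_pos]
    calc (maneuverConst / 2) ^ (J + 1) * h (c 0) = maneuverConst / 2 * ((maneuverConst / 2) ^ J * h (c 0)) := by
          rw [pow_succ]; ring
      _ ≤ maneuverConst / 2 * h (c J) := mul_le_mul_of_nonneg_left h1 hc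
      _ ≤ h (c (J + 1)) := h2

/-- **From the top side to the point next to the base.** If `F` is lattice-harmonic on the open
rectangle `(a₀, a₀+2S) × (a₁, a₁+T)`, nonnegative on its frame, and `≥ m` on the top side, then
`F ≥ m ω_U` on the rectangle; in particular at `o = (a₀ + S, a₁ + 1)`,
`F(o) ≥ m (1/T - T/S²)` (`latticeHM_top_base_ge`, Chelkak–Smirnov's Lemma 3.12). This is the
step `δ ≍ P(o_int) ≥ const · P(T^δ) · ω(o_int; U; R)` of the proof of Thm. 3.13.
[cite: ChelkakSmirnov2011, proof of Thm. 3.13] -/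
theorem mul_latticeHM_top_le (a : Site 2) {S T : ℕ} (hT : 0 < T) {F : Site 2 → ℝ}
    (hF : IsLatticeHarmonicOn F (rectInterior a (2 * S) T))
    (hframe : ∀ w ∈ latticeOuterBoundary (rectInterior a (2 * S) T), 0 ≤ F w) {m : ℝ}
    (htop : ∀ w : Site 2, w 1 = a 1 + T → a 0 < w 0 → w 0 < a 0 + 2 * S → m ≤ F w)
    {v : Site 2} (hv : v ∈ rectInterior a (2 * S) T) :
    m * latticeHM (rectInterior a (2 * S) T) {w : Site 2 | w 1 = a 1 + T} v ≤ F v := by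
  have hR := rectInterior_finite a (2 * S) T
  have hharm : IsLatticeHarmonicOn
      (fun w => F w - m * latticeHM (rectInterior a (2 * S) T) {w : Site 2 | w 1 = a 1 + T} w)
      (rectInterior a (2 * S) T) := by
    intro w hw
    rw [show (fun w => F w - m * latticeHM (rectInterior a (2 * S) T) {w : Site 2 | w 1 = a 1 + T} w) =
        F - fun w => m * latticeHM (rectInterior a (2 * S) T) {w : Site 2 | w 1 = a 1 + T} w from rfl,
      latticeLaplacian_sub, latticeLaplacian_const_mul, latticeHM_harmonicOn hR _ w hw, hF w hw]
    ring
  have key := hharm.superharmonicOn.ge_of_forall_boundary_ge hR (M := 0) (fun w hw => ?_) v hv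
  · linarith [key]
  have hwR : w ∉ rectInterior a (2 * S) T := hw.1
  rcases frame_of_mem_latticeOuterBoundary hw with ⟨h0, h1, h2⟩ | ⟨h1 | h1, h0, h0'⟩
  · have hU : w ∉ {w : Site 2 | w 1 = a 1 + T} := by simp only [Set.mem_setOf_eq]; omega
    rw [latticeHM_of_not_mem_of_not_mem hR hwR hU, mul_zero, sub_zero]; exact hframe w hw
  · have hU : w ∉ {w : Site 2 | w 1 = a 1 + T} := by simp only [Set.mem_setOf_eq]; omega
    rw [latticeHM_of_not_mem_of_not_mem hR hwR hU, mul_zero, sub_zero]; exact hframe w hw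
  · have hU : w ∈ {w : Site 2 | w 1 = a 1 + T} := by simpa only [Set.mem_setOf_eq] using h1
    rw [latticeHM_of_not_mem_of_mem hR hwR hU, mul_one, sub_nonneg]
    exact htop w h1 h0 h0'

/-- The value next to the middle of the base in terms of the minimum over the top side:
`F(o) ≥ m (1/T - T/S²)` for `o = (a₀ + S, a₁ + 1)`, `S ≥ 1`, `T ≥ 2`.
[cite: ChelkakSmirnov2011, proof of Thm. 3.13] -/
theorem base_value_ge (a : Site 2) {S T : ℕ} (hS : 0 < S) (hT : 2 ≤ T) {F : Site 2 → ℝ}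
    (hF : IsLatticeHarmonicOn F (rectInterior a (2 * S) T))
    (hframe : ∀ w ∈ latticeOuterBoundary (rectInterior a (2 * S) T), 0 ≤ F w) {m : ℝ} (hm : 0 ≤ m)
    (htop : ∀ w : Site 2, w 1 = a 1 + T → a 0 < w 0 → w 0 < a 0 + 2 * S → m ≤ F w)
    {o : Site 2} (ho0 : o 0 = a 0 + S) (ho1 : o 1 = a 1 + 1) :
    m * (1 / (T : ℝ) - T / (S : ℝ) ^ 2) ≤ F o := by
  have h1 := mul_latticeHM_top_le a (by omega) hF hframe htop (base_point_mem_rectInterior hS hT ho0 ho1)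
  have h2 := latticeHM_top_base_ge (a := a) hS hT ho0 ho1
  exact (mul_le_mul_of_nonneg_left h2 hm).trans h1

end Corridor

section Assembly

open Real

variable {Λ : Finset (Site 2)} {a b : Site 2}

/-- **From the pole into the bulk.** If `Λ` contains the window of half-width `W` above the pole `b`
(`W ≥ 8 (1/(π c₀) + 2/π) t`) and a Harnack chain of `J` boxes of radius `48k` inside `Λ ∖ {b}`
starts at the axis point `T_b = (b₀, b₁ + t - 1)`, then on the core (radius `12k`) of the last box
`G_Λ(b, ·) ≥ (c_*/2)^{J+1} / (8t)` (`dirichletGreen_axis_ge`, `harnack_chain`, `harnack_box`).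
In the mesh-`δ` picture: `G_V(·, b) ≳ δ` on compacts, uniformly.
[cite: ChelkakSmirnov2011, proof of Thm. 3.13 (a priori bounds)] -/
theorem dirichletGreen_chain_ge {W t : ℕ} (hW : 2 ≤ W) (hsub : windowFinset b W ⊆ Λ) (ht : 1 ≤ t)
    (htW : t + 1 ≤ W) (hWt : 8 * (1 / (π * modeRateConst) + 2 / π) * t ≤ W)
    {k : ℕ} (hk : 0 < k) (c : ℕ → Site 2) {J : ℕ} (hc0 : (c 0) 0 = b 0) (hc1 : (c 0) 1 = b 1 + t - 1)
    (hboxes : ∀ j, j ≤ J → mW (c j) k ⊆ (↑Λ : Set (Site 2)) \ {b})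
    (hsteps : ∀ j, j < J → c (j + 1) ∈ mB (c j) k) {w : Site 2} (hw : w ∈ mB (c J) k) :
    (maneuverConst / 2) ^ (J + 1) / (8 * t) ≤ dirichletGreen Λ b w := by
  set F : Site 2 → ℝ := dirichletGreen Λ b with hF
  have hFpos : ∀ w, 0 ≤ F w := fun w => dirichletGreen_nonneg two_pos Λ b w
  have hFharm := isLatticeHarmonicOn_dirichletGreen Λ b
  -- the axis lower bound at `T_b = c 0`
  have htr : (0 : ℝ) < t := by exact_mod_cast ht
  have hWr : (0 : ℝ) < W := by exact_mod_cast (show 0 < W by omega)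
  have h0 : 1 / (8 * (t : ℝ)) ≤ F (c 0) := by
    have h := dirichletGreen_axis_ge (b := b) hW hsub ht htW hc0 hc1
    have hC : (1 / (π * modeRateConst) + 2 / π) / W ≤ 1 / (8 * t) := by
      rw [div_le_div_iff₀ hWr (by positivity)]
      nlinarith [hWt]
    have e : 1 / (4 * (t : ℝ)) - 1 / (8 * t) = 1 / (8 * t) := by field_simp; ring
    linarith [h, hC, e]
  -- transport along the chain and into the core of the last box
  have hchain := harnack_chain hFpos hk c J (fun j hj => fun v hv => hFharm v (hboxes j hj hv)) hsteps
  have hc2 : 0 ≤ maneuverConst / 2 := by linarith [maneuverConst_pos]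
  have hb := harnack_box (c J) hk (fun v hv => hFharm v (hboxes J le_rfl hv)) hFpos hw
  calc (maneuverConst / 2) ^ (J + 1) / (8 * t) = maneuverConst / 2 * ((maneuverConst / 2) ^ J * (1 / (8 * t))) := by
        rw [pow_succ]; ring
    _ ≤ maneuverConst / 2 * ((maneuverConst / 2) ^ J * F (c 0)) := by gcongr
    _ ≤ maneuverConst / 2 * F (c J) := mul_le_mul_of_nonneg_left hchain hc2
    _ ≤ F w := hb

/-- **Into the normalisation point.** If `G_Λ(b, ·) ≥ m ≥ 0` on the top side of the `2S × T`
rectangle with corner `α` standing on the killed row under `a = (α₀ + S, α₁ + 1)`, the rectangle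
lying in `Λ ∖ {b}`, then `G_Λ(a, b) ≥ m (1/T - T/S²)` (`base_value_ge` and the symmetry of `G_Λ`).
[cite: ChelkakSmirnov2011, proof of Thm. 3.13 (a priori bounds)] -/
theorem dirichletGreen_base_ge (α : Site 2) {S T : ℕ} (hS : 0 < S) (hT : 2 ≤ T)
    (hRa : rectInterior α (2 * S) T ⊆ (↑Λ : Set (Site 2)) \ {b}) {m : ℝ} (hm : 0 ≤ m)
    (htop : ∀ w : Site 2, w 1 = α 1 + T → α 0 < w 0 → w 0 < α 0 + 2 * S → m ≤ dirichletGreen Λ b w)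
    (ha0 : a 0 = α 0 + S) (ha1 : a 1 = α 1 + 1) :
    m * (1 / (T : ℝ) - T / (S : ℝ) ^ 2) ≤ dirichletGreen Λ a b := by
  have hbase := base_value_ge α hS hT (F := dirichletGreen Λ b)
    (fun v hv => isLatticeHarmonicOn_dirichletGreen Λ b v (hRa hv))
    (fun w _ => dirichletGreen_nonneg two_pos Λ b w) hm htop ha0 ha1
  rw [dirichletGreen_comm]
  exact hbase

/-- **Lower bound for the Green function between a flat boundary pole and the normalisation point**
(both in "base below" position), the lattice core of the a priori LOWER bound of Chelkak–Smirnov's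
proof of Thm. 3.13 (`P^δ(T^δ)` bounded ⇔ `G_V(a, b) ≳ δ²`): if `Λ` contains the window of
half-width `W` above the pole `b` (`W ≥ 8 (1/(π c₀) + 2/π) t`), a Harnack chain of `J` boxes of
radius `48k` inside `Λ ∖ {b}` leads from the point `T_b = (b₀, b₁ + t - 1)` above the pole to a box
whose core (radius `12k`) contains the top side of the `2S × T` rectangle standing on the killed
row under `a` (`a = (α₀ + S, α₁ + 1)` for its corner `α`, the rectangle inside `Λ ∖ {b}`), then
`G_Λ(a, b) ≥ (1/T - T/S²) (c_*/2)^{J+1} / (8t)`.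
[cite: ChelkakSmirnov2011, proof of Thm. 3.13 (a priori bounds)] -/
theorem dirichletGreen_pole_ge {W t : ℕ} (hW : 2 ≤ W) (hsub : windowFinset b W ⊆ Λ) (ht : 1 ≤ t)
    (htW : t + 1 ≤ W) (hWt : 8 * (1 / (π * modeRateConst) + 2 / π) * t ≤ W)
    {k : ℕ} (hk : 0 < k) (c : ℕ → Site 2) {J : ℕ} (hc0 : (c 0) 0 = b 0) (hc1 : (c 0) 1 = b 1 + t - 1)
    (hboxes : ∀ j, j ≤ J → mW (c j) k ⊆ (↑Λ : Set (Site 2)) \ {b})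
    (hsteps : ∀ j, j < J → c (j + 1) ∈ mB (c j) k)
    (α : Site 2) {S T : ℕ} (hS : 0 < S) (hT : 2 ≤ T)
    (hRa : rectInterior α (2 * S) T ⊆ (↑Λ : Set (Site 2)) \ {b})
    (htopU : ∀ w : Site 2, w 1 = α 1 + T → α 0 < w 0 → w 0 < α 0 + 2 * S → w ∈ mB (c J) k)
    (ha0 : a 0 = α 0 + S) (ha1 : a 1 = α 1 + 1) :
    (1 / (T : ℝ) - T / (S : ℝ) ^ 2) * ((maneuverConst / 2) ^ (J + 1) / (8 * t)) ≤ dirichletGreen Λ a b := by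
  have hm : 0 ≤ (maneuverConst / 2) ^ (J + 1) / (8 * (t : ℝ)) := by
    have := maneuverConst_pos; positivity
  rw [mul_comm]
  exact dirichletGreen_base_ge α hS hT hRa hm
    (fun w h1 h0 h0' => dirichletGreen_chain_ge hW hsub ht htW hWt hk c hc0 hc1 hboxes hsteps (htopU w h1 h0 h0'))
    ha0 ha1

end Assembly

/-! ### Orientation: the Green function under lattice motions -/

section Motion

/-- **Uniqueness characterisation of `G_Λ(x, ·)`**: a function vanishing off `Λ` whose lattice
Laplacian on `Λ` is `-δ_x` is the Dirichlet Green function with pole `x` (the difference is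
harmonic on `Λ` with zero boundary values). [cite: Lawler1991, §1.5, p. 29] -/
theorem eq_dirichletGreen_of_latticeLaplacian {Λ : Finset (Site 2)} {x : Site 2} {f : Site 2 → ℝ}
    (hoff : ∀ z, z ∉ Λ → f z = 0) (hlap : ∀ z, z ∈ Λ → latticeLaplacian f z = -(if x = z then 1 else 0)) :
    f = dirichletGreen Λ x := by
  have hharm : IsLatticeHarmonicOn (f - dirichletGreen Λ x) ↑Λ := fun z hz => by
    rw [latticeLaplacian_sub, hlap z (Finset.mem_coe.1 hz), latticeLaplacian_dirichletGreen Λ x (Finset.mem_coe.1 hz)]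
    ring
  have hzero : IsLatticeHarmonicOn (fun _ : Site 2 => (0 : ℝ)) ↑Λ := fun z _ => latticeLaplacian_const 0 z
  funext z
  by_cases hz : z ∈ Λ
  · have key := hharm.eq_of_eq_boundary Λ.finite_toSet hzero (fun w hw => ?_) z (Finset.mem_coe.2 hz)
    · rw [Pi.sub_apply] at key; linarith
    · have hwΛ : w ∉ Λ := fun h => hw.1 (Finset.mem_coe.2 h)
      rw [Pi.sub_apply, hoff w hwΛ, dirichletGreen_of_not_mem_right Λ x hwΛ, sub_zero]
  · rw [hoff z hz, dirichletGreen_of_not_mem_right Λ x hz]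

/-- **The Dirichlet Green function is invariant under lattice motions**: for a bijective lattice
motion `σ` of `ℤ²` (translations, the reflections and rotations of the square lattice),
`G_{σΛ}(σ x, σ y) = G_Λ(x, y)`. [folklore] -/
theorem dirichletGreen_map_motion (σ : Site 2 ≃ Site 2) (hσ : IsLatticeMotion σ)
    (Λ : Finset (Site 2)) (x y : Site 2) :
    dirichletGreen (Λ.map σ.toEmbedding) (σ x) (σ y) = dirichletGreen Λ x y := by
  have key : (fun z => dirichletGreen (Λ.map σ.toEmbedding) (σ x) (σ z)) = dirichletGreen Λ x := by
    apply eq_dirichletGreen_of_latticeLaplacian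
    · intro z hz
      exact dirichletGreen_of_not_mem_right _ _ fun h => hz ((Finset.mem_map' σ.toEmbedding).1 h)
    · intro z hz
      rw [hσ.latticeLaplacian_comp (dirichletGreen (Λ.map σ.toEmbedding) (σ x)) z]
      have hz' : σ z ∈ Λ.map σ.toEmbedding := (Finset.mem_map' σ.toEmbedding).2 hz
      rw [latticeLaplacian_dirichletGreen _ _ hz']
      simp only [EmbeddingLike.apply_eq_iff_eq]
  exact congrFun key y

/-- The vertical flip `(i, j) ↦ (i, -j)` of `ℤ²`. [folklore] -/
def flipV : Site 2 ≃ Site 2 where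
  toFun v := ![v 0, -v 1]
  invFun v := ![v 0, -v 1]
  left_inv v := by ext i; fin_cases i <;> simp
  right_inv v := by ext i; fin_cases i <;> simp

/-- The transposition `(i, j) ↦ (j, i)` of `ℤ²` (reflection in the diagonal). [folklore] -/
def transposeSite : Site 2 ≃ Site 2 where
  toFun v := ![v 1, v 0]
  invFun v := ![v 1, v 0]
  left_inv v := by ext i; fin_cases i <;> simp
  right_inv v := by ext i; fin_cases i <;> simp

/-- First coordinate of the vertical flip. [folklore] -/
@[simp] theorem flipV_apply_zero (v : Site 2) : flipV v 0 = v 0 := rfl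

/-- Second coordinate of the vertical flip. [folklore] -/
@[simp] theorem flipV_apply_one (v : Site 2) : flipV v 1 = -v 1 := rfl

/-- First coordinate of the transposition. [folklore] -/
@[simp] theorem transposeSite_apply_zero (v : Site 2) : transposeSite v 0 = v 1 := rfl

/-- Second coordinate of the transposition. [folklore] -/
@[simp] theorem transposeSite_apply_one (v : Site 2) : transposeSite v 1 = v 0 := rfl

/-- The vertical flip is a lattice motion (it exchanges the steps up and down). [folklore] -/
theorem isLatticeMotion_flipV : IsLatticeMotion flipV := by
  refine ⟨Equiv.swap 1 3, fun x k => ?_⟩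
  fin_cases k <;> ext i <;> fin_cases i <;>
    simp [flipV, cornerUnit, Equiv.swap_apply_of_ne_of_ne, Equiv.swap_apply_left, Equiv.swap_apply_right] <;>
    ring

/-- The transposition is a lattice motion (it exchanges east/north and west/south). [folklore] -/
theorem isLatticeMotion_transposeSite : IsLatticeMotion transposeSite := by
  refine ⟨(Equiv.swap 0 1).trans (Equiv.swap 2 3), fun x k => ?_⟩
  fin_cases k <;> ext i <;> fin_cases i <;>
    simp [transposeSite, cornerUnit, Equiv.swap_apply_of_ne_of_ne, Equiv.swap_apply_left,
      Equiv.swap_apply_right, Equiv.trans_apply]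

end Motion

end Literature.Probability.LatticeModels
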